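import Literature.AlgebraicGeometry.Motives.UniversalHyperplaneSectionFamilySlice
import Literature.AlgebraicGeometry.Motives.SmoothProjectiveFamilyOverOpen
import Literature.AlgebraicGeometry.Motives.SegrePowers
import Literature.AlgebraicGeometry.Motives.LinearSectionNetBertini
import HarnessLib

/-!
# The family of hyperplane sections of the fibres of a smooth projective family, V: a pencil of a fibre inside the family

Topic `Literature/AlgebraicGeometry/Motives` (theorems only). For `g : 𝒴 ⟶ S × (ℙᴺ)^*` as in
`Motives/UniversalHyperplaneSectionFamily`, a complex point `t` of `S`, a pencil `a = (a₀, a₁)` of the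
fibre `X_t ⊆ ℙᴺ` and its line `Λ : ℙ¹ ⟶ (ℙᴺ)^*`:

* `pt_map_pencilToProduct_mem_incidenceLocus`, `exists_pencilToSection` — the total space `X̃_t` of the
  pencil maps to `𝒴` over `𝒳 × (ℙᴺ)^*` (the two incidence equations agree);
* `pencilToSection_comm`, `isClosedImmersion_pencilToSectionLine`, `pt_mem_range_pencilToSectionLine`,
  `exists_pencilToSectionLine` — `(Θ, π) : X̃_t ⟶ 𝒴_L := 𝒴 ×_{S × (ℙᴺ)^*} ℙ¹` is a surjective closed
  immersion.

## References

* [VoisinHodgeII2003] C. Voisin, Hodge Theory and Complex Algebraic Geometry II, CUP 2003, §2.1.1 and §3.2.2.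
* [StacksProject] The Stacks Project, Tags 0356, 04XV, 01T6.
-/

noncomputable section

open CategoryTheory CategoryTheory.Limits AlgebraicGeometry TopologicalSpace MonoidalCategory
  CartesianMonoidalCategory
open Literature.AlgebraicGeometry.HodgeTheory
open Literature.AlgebraicGeometry.Motives.UniversalHyperplaneSection

universe u

namespace Literature.AlgebraicGeometry.Motives.SectionFamily

/-! ### The pencil of a fibre mapped into the family of sections: `Θ : X̃_t ⟶ 𝒴` -/
section PencilToSection

open Literature.AlgebraicGeometry.Resolution

variable {N : ℕ} {𝒳 S : SchemeOver ℂ} (f : 𝒳 ⟶ S) (e : 𝒳 ⟶ projectiveSpace N ℂ)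
  (t : ComplexPoints S) (a : Fin (1 + 1) → Fin (N + 1) → ℂ)
  (Λ : projectiveSpace 1 ℂ ⟶ dualProjectiveSpace N ℂ)

/-- **The incidence equation transported**: if `Λ` maps `[w] ∈ ℙ¹(ℂ)` to the hyperplane
`[w₁ a₀ − w₀ a₁] ∈ (ℙᴺ)^*(ℂ)`, then for every complex point `P` of the total space `X̃_t` of the
pencil `a` of `X_t ⊆ ℙᴺ` (embedded by `X_t ⟶ 𝒳 ⟶ ℙᴺ`), the point `(σ(P), Λ(π(P)))` of `𝒳 × (ℙᴺ)^*`
lies in the incidence locus `{(x, H) | e(x) ∈ H}` — both memberships say `w₁ a₀(z) = w₀ a₁(z)` for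
`e(σ(P)) = [z]` (`LinearSectionNet.pt_lift_mem_locus_iff`, `ProjectiveSpace.pt_lift_mem_incidenceLocus_iff`).
[cite: VoisinHodgeII2003, §2.1.1] -/
theorem pt_map_pencilToProduct_mem_incidenceLocus [IsClosedImmersion (fiberι f t ≫ e).left]
    (hΛ : ∀ (w : Fin (1 + 1) → ℂ) (hw : w ≠ 0), ∃ hc : (fun i => w 1 * a 0 i - w 0 * a 1 i) ≠ 0,
      AlgPoints.map Λ (ProjectiveSpace.pointOfVec ℂ w hw) =
        ProjectiveSpace.pointOfVec ℂ (fun i => w 1 * a 0 i - w 0 * a 1 i) hc)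
    (P : ComplexPoints (LinearSectionNet.total (fiberι f t ≫ e) a)) :
    AlgPoints.pt (AlgPoints.map (CartesianMonoidalCategory.lift
        (LinearSectionNet.blowDown (fiberι f t ≫ e) a ≫ fiberι f t)
        (LinearSectionNet.proj (fiberι f t ≫ e) a ≫ Λ)) P) ∈
      (incidenceLocus N e : Set (𝒳 ⊗ dualProjectiveSpace N ℂ).left) := by
  obtain ⟨w, hw, hPw⟩ := ProjectiveSpace.exists_eq_pointOfVec
    (AlgPoints.map (LinearSectionNet.proj (fiberι f t ≫ e) a) P)
  obtain ⟨z, hz, hxz⟩ := ProjectiveSpace.exists_eq_pointOfVec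
    (AlgPoints.map (fiberι f t ≫ e) (AlgPoints.map (LinearSectionNet.blowDown (fiberι f t ≫ e) a) P))
  obtain ⟨hc, hΛw⟩ := hΛ w hw
  -- the incidence equation of the pencil at `P`
  have hinc : LinearSectionNet.linEval (a 0) z * w 1 = LinearSectionNet.linEval (a 1) z * w 0 := by
    rw [← pt_lift_mem_locus_iff (fiberι f t ≫ e) a _ z hz hxz w hw, ← hPw, ← LinearSectionNet.range_emb]
    have h := eq_lift_map_fst_map_snd (AlgPoints.map (LinearSectionNet.emb (fiberι f t ≫ e) a) P)
    rw [← AlgPoints.map_comp_apply, ← AlgPoints.map_comp_apply] at h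
    change AlgPoints.map (LinearSectionNet.emb (fiberι f t ≫ e) a) P =
      CartesianMonoidalCategory.lift (AlgPoints.map (LinearSectionNet.blowDown (fiberι f t ≫ e) a) P)
        (AlgPoints.map (LinearSectionNet.proj (fiberι f t ≫ e) a) P) at h
    rw [← h, AlgPoints.pt_map]
    exact ⟨_, rfl⟩
  -- the incidence equation of the universal hyperplane section at `(σ P, Λ (π P))`
  have hmap : AlgPoints.map (CartesianMonoidalCategory.lift
      (LinearSectionNet.blowDown (fiberι f t ≫ e) a ≫ fiberι f t)
      (LinearSectionNet.proj (fiberι f t ≫ e) a ≫ Λ)) P =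
      CartesianMonoidalCategory.lift
        (AlgPoints.map (fiberι f t) (AlgPoints.map (LinearSectionNet.blowDown (fiberι f t ≫ e) a) P))
        (ProjectiveSpace.pointOfVec ℂ (fun i => w 1 * a 0 i - w 0 * a 1 i) hc) := by
    rw [AlgPoints.map_apply, CartesianMonoidalCategory.comp_lift, ← hΛw, ← hPw, ← Category.assoc,
      ← Category.assoc]
    rfl
  rw [hmap, ProjectiveSpace.pt_lift_mem_incidenceLocus_iff e _ hz
    (by rw [← AlgPoints.map_comp_apply]; exact hxz) hc]
  have h' : ∑ i, z i * (w 1 * a 0 i - w 0 * a 1 i) =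
      w 1 * LinearSectionNet.linEval (a 0) z - w 0 * LinearSectionNet.linEval (a 1) z := by
    simp only [LinearSectionNet.linEval, Algebra.algebraMap_self, RingHom.id_apply, Finset.mul_sum,
      ← Finset.sum_sub_distrib]
    exact Finset.sum_congr rfl fun i _ => by ring
  rw [h', mul_comm (w 1), mul_comm (w 0), hinc, sub_self]

/-- **The pencil of the fibre `X_t` maps into the family of sections**: there is a morphism
`Θ : X̃_t ⟶ 𝒴` over `𝒳 × (ℙᴺ)^*`, i.e. with `Θ ≫ toX = σ ≫ ι_t` and `Θ ≫ proj = π ≫ Λ` (`X̃_t` is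
reduced and `(σ, Λ ∘ π)` lands in the incidence locus: `pt_map_pencilToProduct_mem_incidenceLocus` on
closed points, which suffice in a Jacobson space; then the universal property of the reduced closed
subscheme `𝒴`, Stacks 0356). [cite: StacksProject, Tag 0356] [cite: VoisinHodgeII2003, §2.1.1] -/
 theorem exists_pencilToSection {n' : ℕ} [IsClosedImmersion (fiberι f t ≫ e).left]
    (hXt : IsSmoothProjective n' (fiberOver f t))
    (hΛ : ∀ (w : Fin (1 + 1) → ℂ) (hw : w ≠ 0), ∃ hc : (fun i => w 1 * a 0 i - w 0 * a 1 i) ≠ 0,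
      AlgPoints.map Λ (ProjectiveSpace.pointOfVec ℂ w hw) =
        ProjectiveSpace.pointOfVec ℂ (fun i => w 1 * a 0 i - w 0 * a 1 i) hc) :
    ∃ Θ : LinearSectionNet.total (fiberι f t ≫ e) a ⟶ universalHyperplaneSection N e,
      Θ ≫ toX N e = LinearSectionNet.blowDown (fiberι f t ≫ e) a ≫ fiberι f t ∧
      Θ ≫ proj N e = LinearSectionNet.proj (fiberι f t ≫ e) a ≫ Λ := by
  set Θ₀ : LinearSectionNet.total (fiberι f t ≫ e) a ⟶ 𝒳 ⊗ dualProjectiveSpace N ℂ :=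
    CartesianMonoidalCategory.lift (LinearSectionNet.blowDown (fiberι f t ≫ e) a ≫ fiberι f t)
      (LinearSectionNet.proj (fiberι f t ≫ e) a ≫ Λ) with hΘ₀
  haveI := LinearSectionNet.locallyOfFiniteType_total_hom (fiberι f t ≫ e) hXt a
  -- the range of `Θ₀` lies in the incidence locus (closed points suffice)
  have hrange : Set.range Θ₀.left.base ⊆ Set.range (emb N e).left.base := by
    rw [range_emb]
    have hcl : IsClosed (Θ₀.left.base ⁻¹' (incidenceLocus N e : Set (𝒳 ⊗ dualProjectiveSpace N ℂ).left)) :=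
      (incidenceLocus N e).isClosed.preimage Θ₀.left.continuous
    have huniv := eq_univ_of_closedPoints_subset (Y := LinearSectionNet.total (fiberι f t ≫ e) a) hcl
      fun y hy => by
      obtain ⟨P, rfl⟩ := EsnaultLevineViehweg.exists_algPoints_pt_eq
        (X := LinearSectionNet.total (fiberι f t ≫ e) a) (k := ℂ) (mem_closedPoints_iff.mp hy)
      rw [Set.mem_preimage, ← AlgPoints.pt_map]
      exact pt_map_pencilToProduct_mem_incidenceLocus f e t a Λ hΛ P
    rintro _ ⟨y, rfl⟩
    have hy : y ∈ Θ₀.left.base ⁻¹' (incidenceLocus N e : Set _) := huniv ▸ Set.mem_univ y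
    exact hy
  refine ⟨Over.homMk (liftOfRangeSubset (emb N e).left Θ₀.left hrange) ?_, ?_, ?_⟩
  · rw [← Over.w (emb N e), ← Category.assoc, liftOfRangeSubset_comp, Over.w Θ₀]
  · have h : Over.homMk (liftOfRangeSubset (emb N e).left Θ₀.left hrange)
        (by rw [← Over.w (emb N e), ← Category.assoc, liftOfRangeSubset_comp, Over.w Θ₀]) ≫ emb N e = Θ₀ :=
      Over.OverMorphism.ext (liftOfRangeSubset_comp _ _ hrange)
    change _ ≫ emb N e ≫ fst _ _ = _
    rw [← Category.assoc, h, hΘ₀, CartesianMonoidalCategory.lift_fst]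
  · have h : Over.homMk (liftOfRangeSubset (emb N e).left Θ₀.left hrange)
        (by rw [← Over.w (emb N e), ← Category.assoc, liftOfRangeSubset_comp, Over.w Θ₀]) ≫ emb N e = Θ₀ :=
      Over.OverMorphism.ext (liftOfRangeSubset_comp _ _ hrange)
    change _ ≫ emb N e ≫ snd _ _ = _
    rw [← Category.assoc, h, hΘ₀, CartesianMonoidalCategory.lift_snd]

end PencilToSection

/-! ### `Θ_L : X̃_t ⟶ 𝒴_L = 𝒴 ×_{S × (ℙᴺ)^*} ℙ¹`: a surjective closed immersion -/
section PencilToSectionFamily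

open Literature.AlgebraicGeometry.Resolution

variable {n N : ℕ} {𝒳 S : SchemeOver ℂ} (f : 𝒳 ⟶ S) (e : 𝒳 ⟶ projectiveSpace N ℂ)
  (t : ComplexPoints S) (a : Fin (1 + 1) → Fin (N + 1) → ℂ)
  (Λ : projectiveSpace 1 ℂ ⟶ dualProjectiveSpace N ℂ)

/-- `Θ ≫ g = π ≫ ℓ` for `Θ : X̃_t ⟶ 𝒴` over `𝒳 × (ℙᴺ)^*` and `ℓ = Λ ≫ (H ↦ (t, H))`. [folklore] -/
theorem pencilToSection_comm {Θ : LinearSectionNet.total (fiberι f t ≫ e) a ⟶ universalHyperplaneSection N e}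
    (hΘX : Θ ≫ toX N e = LinearSectionNet.blowDown (fiberι f t ≫ e) a ≫ fiberι f t)
    (hΘP : Θ ≫ proj N e = LinearSectionNet.proj (fiberι f t ≫ e) a ≫ Λ) :
    Θ ≫ CartesianMonoidalCategory.lift (toX N e ≫ f) (proj N e) =
      LinearSectionNet.proj (fiberι f t ≫ e) a ≫ Λ ≫
        CartesianMonoidalCategory.lift (toSpecOver (dualProjectiveSpace N ℂ) ≫ t) (𝟙 (dualProjectiveSpace N ℂ)) := by
  rw [CartesianMonoidalCategory.comp_lift, CartesianMonoidalCategory.comp_lift,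
    CartesianMonoidalCategory.comp_lift, Category.comp_id, ← Category.assoc Θ, hΘX, hΘP]
  congr 1
  rw [Category.assoc, fiberι_comp, ← Category.assoc, ← Category.assoc, ← Category.assoc,
    Literature.AlgebraicGeometry.Motives.eq_toSpecOver (LinearSectionNet.blowDown _ a ≫ fiberOverToSpec f t),
    Literature.AlgebraicGeometry.Motives.eq_toSpecOver ((LinearSectionNet.proj _ a ≫ Λ) ≫ toSpecOver _)]

/-- **`(Θ, π) : X̃_t ⟶ 𝒴_L` is a closed immersion**: proper (`X̃_t` is proper, `𝒴_L` separated) and a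
monomorphism, because `X̃_t ⟶ 𝒴_L ⟶ 𝒳 × ℙ¹` is the closed immersion `X̃_t ↪ X_t × ℙ¹ ↪ 𝒳 × ℙ¹`
(Stacks 04XV). [cite: StacksProject, Tag 04XV] -/
theorem isClosedImmersion_pencilToSectionLine [IsClosedImmersion (fiberι f t ≫ e).left] [IsAffine S.left]
    [LocallyOfFiniteType S.hom] (hf : IsSmoothProjectiveFamily f (n + 1))
    {Θ : LinearSectionNet.total (fiberι f t ≫ e) a ⟶ universalHyperplaneSection N e}
    (hΘX : Θ ≫ toX N e = LinearSectionNet.blowDown (fiberι f t ≫ e) a ≫ fiberι f t)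
    {ΘL : LinearSectionNet.total (fiberι f t ≫ e) a ⟶
        familyPullback (CartesianMonoidalCategory.lift (toX N e ≫ f) (proj N e))
          (Λ ≫ CartesianMonoidalCategory.lift (toSpecOver (dualProjectiveSpace N ℂ) ≫ t) (𝟙 (dualProjectiveSpace N ℂ)))}
    (hΘL₁ : ΘL ≫ familyPullback.fst _ _ = Θ)
    (hΘL₂ : ΘL ≫ familyPullback.snd _ _ = LinearSectionNet.proj (fiberι f t ≫ e) a) :
    IsClosedImmersion ΘL.left := by
  have hXt : IsSmoothProjective (n + 1) (fiberOver f t) := hf.isSmoothProjective t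
  haveI : IsSeparated S.hom := inferInstance
  haveI := isSeparated_total_hom f hf
  haveI : IsProper (LinearSectionNet.total (fiberι f t ≫ e) a).hom :=
    LinearSectionNet.isProper_total_hom (fiberι f t ≫ e) hXt a
  haveI : IsSeparated (universalHyperplaneSection N e).hom := isSeparated_universalHyperplaneSection_hom N e
  haveI : IsSeparated (Λ ≫ (CartesianMonoidalCategory.lift (toSpecOver (dualProjectiveSpace N ℂ) ≫ t) (𝟙 (dualProjectiveSpace N ℂ)))).left := by
    haveI : IsSeparated (projectiveSpace 1 ℂ).hom := inferInstance
    have h : IsSeparated ((Λ ≫ (CartesianMonoidalCategory.lift (toSpecOver (dualProjectiveSpace N ℂ) ≫ t) (𝟙 (dualProjectiveSpace N ℂ)))).left ≫ (S ⊗ dualProjectiveSpace N ℂ).hom) := by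
      rw [Over.w]; infer_instance
    exact IsSeparated.of_comp (Λ ≫ (CartesianMonoidalCategory.lift (toSpecOver (dualProjectiveSpace N ℂ) ≫ t) (𝟙 (dualProjectiveSpace N ℂ)))).left (S ⊗ dualProjectiveSpace N ℂ).hom
  haveI : IsSeparated (familyPullback (CartesianMonoidalCategory.lift (toX N e ≫ f) (proj N e)) (Λ ≫ (CartesianMonoidalCategory.lift (toSpecOver (dualProjectiveSpace N ℂ) ≫ t) (𝟙 (dualProjectiveSpace N ℂ))))).hom := by
    rw [familyPullback_hom]
    have h1 : IsSeparated (pullback.fst (CartesianMonoidalCategory.lift (toX N e ≫ f) (proj N e)).left (Λ ≫ (CartesianMonoidalCategory.lift (toSpecOver (dualProjectiveSpace N ℂ) ≫ t) (𝟙 (dualProjectiveSpace N ℂ)))).left) :=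
      MorphismProperty.pullback_fst (P := @IsSeparated) _ _ inferInstance
    exact MorphismProperty.comp_mem @IsSeparated _ _ h1 ‹IsSeparated (universalHyperplaneSection N e).hom›
  haveI : IsProper ΘL.left := by
    haveI : IsProper (ΘL.left ≫ (familyPullback (CartesianMonoidalCategory.lift (toX N e ≫ f) (proj N e)) (Λ ≫ (CartesianMonoidalCategory.lift (toSpecOver (dualProjectiveSpace N ℂ) ≫ t) (𝟙 (dualProjectiveSpace N ℂ))))).hom) := by rw [Over.w ΘL]; infer_instance
    exact IsProper.of_comp ΘL.left (familyPullback (CartesianMonoidalCategory.lift (toX N e ≫ f) (proj N e)) (Λ ≫ (CartesianMonoidalCategory.lift (toSpecOver (dualProjectiveSpace N ℂ) ≫ t) (𝟙 (dualProjectiveSpace N ℂ))))).hom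
  -- `ΘL ≫ (pr_𝒳 ∘ toX, pr_ℙ¹) = emb ≫ (ι_t ▷ ℙ¹)` is a closed immersion
  have hj : ΘL ≫ CartesianMonoidalCategory.lift (familyPullback.fst (CartesianMonoidalCategory.lift (toX N e ≫ f) (proj N e)) (Λ ≫ (CartesianMonoidalCategory.lift (toSpecOver (dualProjectiveSpace N ℂ) ≫ t) (𝟙 (dualProjectiveSpace N ℂ)))) ≫ toX N e)
      (familyPullback.snd (CartesianMonoidalCategory.lift (toX N e ≫ f) (proj N e)) (Λ ≫ (CartesianMonoidalCategory.lift (toSpecOver (dualProjectiveSpace N ℂ) ≫ t) (𝟙 (dualProjectiveSpace N ℂ))))) =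
      LinearSectionNet.emb (fiberι f t ≫ e) a ≫ (fiberι f t ▷ projectiveSpace 1 ℂ) := by
    rw [CartesianMonoidalCategory.comp_lift, ← Category.assoc, hΘL₁, hΘX, hΘL₂]
    refine CartesianMonoidalCategory.hom_ext _ _ ?_ ?_
    · rw [lift_fst, Category.assoc, whiskerRight_fst]
      rfl
    · rw [lift_snd, Category.assoc, whiskerRight_snd]
      rfl
  haveI := isClosedImmersion_fiberι_left f t
  haveI := isClosedImmersion_whiskerRight_left (fiberι f t) (projectiveSpace 1 ℂ)
  haveI : Mono (ΘL.left ≫ (CartesianMonoidalCategory.lift (familyPullback.fst (CartesianMonoidalCategory.lift (toX N e ≫ f) (proj N e)) (Λ ≫ (CartesianMonoidalCategory.lift (toSpecOver (dualProjectiveSpace N ℂ) ≫ t) (𝟙 (dualProjectiveSpace N ℂ)))) ≫ toX N e)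
      (familyPullback.snd (CartesianMonoidalCategory.lift (toX N e ≫ f) (proj N e)) (Λ ≫ (CartesianMonoidalCategory.lift (toSpecOver (dualProjectiveSpace N ℂ) ≫ t) (𝟙 (dualProjectiveSpace N ℂ)))))).left) := by
    rw [← Over.comp_left, hj, Over.comp_left]
    infer_instance
  haveI : Mono ΘL.left := mono_of_mono ΘL.left
    (CartesianMonoidalCategory.lift (familyPullback.fst (CartesianMonoidalCategory.lift (toX N e ≫ f) (proj N e)) (Λ ≫ (CartesianMonoidalCategory.lift (toSpecOver (dualProjectiveSpace N ℂ) ≫ t) (𝟙 (dualProjectiveSpace N ℂ)))) ≫ toX N e) (familyPullback.snd (CartesianMonoidalCategory.lift (toX N e ≫ f) (proj N e)) (Λ ≫ (CartesianMonoidalCategory.lift (toSpecOver (dualProjectiveSpace N ℂ) ≫ t) (𝟙 (dualProjectiveSpace N ℂ)))))).left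
  exact (IsClosedImmersion.iff_isProper_and_mono _).mpr ⟨inferInstance, inferInstance⟩

/-- **`(Θ, π) : X̃_t ⟶ 𝒴_L` hits every closed point**: a complex point `((x, H_λ), λ)` of `𝒴_L` comes
from the point `(x, λ)` of `X̃_t` — the two incidence equations agree
(`LinearSectionNet.pt_lift_mem_locus_iff`, `ProjectiveSpace.pt_lift_mem_incidenceLocus_iff`).
[cite: VoisinHodgeII2003, §2.1.1] -/
theorem pt_mem_range_pencilToSectionLine [IsClosedImmersion (fiberι f t ≫ e).left]
    (hΛ : ∀ (w : Fin (1 + 1) → ℂ) (hw : w ≠ 0), ∃ hc : (fun i => w 1 * a 0 i - w 0 * a 1 i) ≠ 0,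
      AlgPoints.map Λ (ProjectiveSpace.pointOfVec ℂ w hw) =
        ProjectiveSpace.pointOfVec ℂ (fun i => w 1 * a 0 i - w 0 * a 1 i) hc)
    {Θ : LinearSectionNet.total (fiberι f t ≫ e) a ⟶ universalHyperplaneSection N e}
    (hΘX : Θ ≫ toX N e = LinearSectionNet.blowDown (fiberι f t ≫ e) a ≫ fiberι f t)
    (hΘP : Θ ≫ proj N e = LinearSectionNet.proj (fiberι f t ≫ e) a ≫ Λ)
    {ΘL : LinearSectionNet.total (fiberι f t ≫ e) a ⟶
        familyPullback (CartesianMonoidalCategory.lift (toX N e ≫ f) (proj N e))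
          (Λ ≫ CartesianMonoidalCategory.lift (toSpecOver (dualProjectiveSpace N ℂ) ≫ t) (𝟙 (dualProjectiveSpace N ℂ)))}
    (hΘL₁ : ΘL ≫ familyPullback.fst _ _ = Θ)
    (hΘL₂ : ΘL ≫ familyPullback.snd _ _ = LinearSectionNet.proj (fiberι f t ≫ e) a)
    (u : ComplexPoints (familyPullback (CartesianMonoidalCategory.lift (toX N e ≫ f) (proj N e))
          (Λ ≫ CartesianMonoidalCategory.lift (toSpecOver (dualProjectiveSpace N ℂ) ≫ t) (𝟙 (dualProjectiveSpace N ℂ))))) :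
    u.pt ∈ Set.range ΘL.left.base := by
  -- the data of `u`: `y' ∈ 𝒴(ℂ)` over `(t, Λ λ)`, `λ ∈ ℙ¹(ℂ)`
  have hgy : AlgPoints.map (CartesianMonoidalCategory.lift (toX N e ≫ f) (proj N e)) (AlgPoints.map (familyPullback.fst (CartesianMonoidalCategory.lift (toX N e ≫ f) (proj N e)) (Λ ≫ (CartesianMonoidalCategory.lift (toSpecOver (dualProjectiveSpace N ℂ) ≫ t) (𝟙 (dualProjectiveSpace N ℂ))))) u) =
      CartesianMonoidalCategory.lift t (AlgPoints.map Λ (AlgPoints.map (familyPullback.snd (CartesianMonoidalCategory.lift (toX N e ≫ f) (proj N e)) (Λ ≫ (CartesianMonoidalCategory.lift (toSpecOver (dualProjectiveSpace N ℂ) ≫ t) (𝟙 (dualProjectiveSpace N ℂ))))) u)) := by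
    rw [← AlgPoints.map_comp_apply, familyPullback.condition, AlgPoints.map_comp_apply, AlgPoints.map_comp_apply,
      map_slice]
  obtain ⟨w, hw, hlam⟩ := ProjectiveSpace.exists_eq_pointOfVec (AlgPoints.map (familyPullback.snd (CartesianMonoidalCategory.lift (toX N e ≫ f) (proj N e)) (Λ ≫ (CartesianMonoidalCategory.lift (toSpecOver (dualProjectiveSpace N ℂ) ≫ t) (𝟙 (dualProjectiveSpace N ℂ))))) u)
  obtain ⟨hc, hΛw⟩ := hΛ w hw
  have hgf : (CartesianMonoidalCategory.lift (toX N e ≫ f) (proj N e)) ≫ fst S (dualProjectiveSpace N ℂ) = toX N e ≫ f := sectionFamily_fst f e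
  have hgs : (CartesianMonoidalCategory.lift (toX N e ≫ f) (proj N e)) ≫ snd S (dualProjectiveSpace N ℂ) = proj N e := sectionFamily_snd f e
  have hxt : AlgPoints.map f (AlgPoints.map (toX N e) (AlgPoints.map (familyPullback.fst (CartesianMonoidalCategory.lift (toX N e ≫ f) (proj N e)) (Λ ≫ (CartesianMonoidalCategory.lift (toSpecOver (dualProjectiveSpace N ℂ) ≫ t) (𝟙 (dualProjectiveSpace N ℂ))))) u)) = t := by
    have h := congrArg (AlgPoints.map (fst S (dualProjectiveSpace N ℂ))) hgy
    rw [← AlgPoints.map_comp_apply, hgf, AlgPoints.map_comp_apply,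
      AlgPoints.map_apply (fst S _) (CartesianMonoidalCategory.lift t _), CartesianMonoidalCategory.lift_fst] at h
    exact h
  have hproj : AlgPoints.map (proj N e) (AlgPoints.map (familyPullback.fst (CartesianMonoidalCategory.lift (toX N e ≫ f) (proj N e)) (Λ ≫ (CartesianMonoidalCategory.lift (toSpecOver (dualProjectiveSpace N ℂ) ≫ t) (𝟙 (dualProjectiveSpace N ℂ))))) u) =
      ProjectiveSpace.pointOfVec ℂ (fun i => w 1 * a 0 i - w 0 * a 1 i) hc := by
    have h := congrArg (AlgPoints.map (snd S (dualProjectiveSpace N ℂ))) hgy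
    rw [← AlgPoints.map_comp_apply, hgs,
      AlgPoints.map_apply (snd S _) (CartesianMonoidalCategory.lift t _), CartesianMonoidalCategory.lift_snd,
      hlam, hΛw] at h
    exact h
  obtain ⟨x', hx'⟩ : AlgPoints.map (toX N e) (AlgPoints.map (familyPullback.fst (CartesianMonoidalCategory.lift (toX N e ≫ f) (proj N e)) (Λ ≫ (CartesianMonoidalCategory.lift (toSpecOver (dualProjectiveSpace N ℂ) ≫ t) (𝟙 (dualProjectiveSpace N ℂ))))) u) ∈
      Set.range (AlgPoints.map (fiberι f t)) := by
    rw [AlgPoints.range_map_fiberι]; exact hxt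
  obtain ⟨zc, hzc, hxz⟩ := ProjectiveSpace.exists_eq_pointOfVec (AlgPoints.map (fiberι f t ≫ e) x')
  -- the incidence equation of `𝒴` at `y'`
  have hemb : AlgPoints.map (emb N e) (AlgPoints.map (familyPullback.fst (CartesianMonoidalCategory.lift (toX N e ≫ f) (proj N e)) (Λ ≫ (CartesianMonoidalCategory.lift (toSpecOver (dualProjectiveSpace N ℂ) ≫ t) (𝟙 (dualProjectiveSpace N ℂ))))) u) =
      CartesianMonoidalCategory.lift (AlgPoints.map (toX N e) (AlgPoints.map (familyPullback.fst (CartesianMonoidalCategory.lift (toX N e ≫ f) (proj N e)) (Λ ≫ (CartesianMonoidalCategory.lift (toSpecOver (dualProjectiveSpace N ℂ) ≫ t) (𝟙 (dualProjectiveSpace N ℂ))))) u))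
        (AlgPoints.map (proj N e) (AlgPoints.map (familyPullback.fst (CartesianMonoidalCategory.lift (toX N e ≫ f) (proj N e)) (Λ ≫ (CartesianMonoidalCategory.lift (toSpecOver (dualProjectiveSpace N ℂ) ≫ t) (𝟙 (dualProjectiveSpace N ℂ))))) u)) := by
    conv_lhs => rw [eq_lift_map_fst_map_snd (AlgPoints.map (emb N e) _)]
    exact congrArg₂ _ (AlgPoints.map_comp_apply (emb N e) (fst _ _) _).symm
      (AlgPoints.map_comp_apply (emb N e) (snd _ _) _).symm
  have hinc : ∑ i, zc i * (w 1 * a 0 i - w 0 * a 1 i) = 0 := by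
    rw [← ProjectiveSpace.pt_lift_mem_incidenceLocus_iff e
      (AlgPoints.map (toX N e) (AlgPoints.map (familyPullback.fst (CartesianMonoidalCategory.lift (toX N e ≫ f) (proj N e)) (Λ ≫ (CartesianMonoidalCategory.lift (toSpecOver (dualProjectiveSpace N ℂ) ≫ t) (𝟙 (dualProjectiveSpace N ℂ))))) u)) hzc
      (by rw [← hx', ← AlgPoints.map_comp_apply]; exact hxz) hc, ← hproj, ← hemb, AlgPoints.pt_map, ← range_emb]
    exact ⟨_, rfl⟩
  -- hence the pencil incidence equation, and a point `z ∈ X̃_t(ℂ)` over `(x', λ)`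
  have hloc : AlgPoints.pt (CartesianMonoidalCategory.lift x' (AlgPoints.map (familyPullback.snd (CartesianMonoidalCategory.lift (toX N e ≫ f) (proj N e)) (Λ ≫ (CartesianMonoidalCategory.lift (toSpecOver (dualProjectiveSpace N ℂ) ≫ t) (𝟙 (dualProjectiveSpace N ℂ))))) u)) ∈
      Set.range (LinearSectionNet.emb (fiberι f t ≫ e) a).left.base := by
    rw [LinearSectionNet.range_emb, hlam, pt_lift_mem_locus_iff (fiberι f t ≫ e) a x' zc hzc hxz w hw]
    have h' : ∑ i, zc i * (w 1 * a 0 i - w 0 * a 1 i) =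
        w 1 * LinearSectionNet.linEval (a 0) zc - w 0 * LinearSectionNet.linEval (a 1) zc := by
      simp only [LinearSectionNet.linEval, Algebra.algebraMap_self, RingHom.id_apply, Finset.mul_sum,
        ← Finset.sum_sub_distrib]
      exact Finset.sum_congr rfl fun i _ => by ring
    rw [h', sub_eq_zero, mul_comm (w 1), mul_comm (w 0)] at hinc
    exact hinc
  obtain ⟨z, hz⟩ : ∃ z : ComplexPoints (LinearSectionNet.total (fiberι f t ≫ e) a),
      AlgPoints.map (LinearSectionNet.emb (fiberι f t ≫ e) a) z =
        CartesianMonoidalCategory.lift x' (AlgPoints.map (familyPullback.snd (CartesianMonoidalCategory.lift (toX N e ≫ f) (proj N e)) (Λ ≫ (CartesianMonoidalCategory.lift (toSpecOver (dualProjectiveSpace N ℂ) ≫ t) (𝟙 (dualProjectiveSpace N ℂ))))) u) :=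
    ⟨AlgPoints.liftClosed (LinearSectionNet.emb (fiberι f t ≫ e) a) _ hloc, AlgPoints.map_liftClosed _ _ hloc⟩
  have hzσ : AlgPoints.map (LinearSectionNet.blowDown (fiberι f t ≫ e) a) z = x' := by
    change AlgPoints.map (LinearSectionNet.emb (fiberι f t ≫ e) a ≫ fst _ _) z = x'
    rw [AlgPoints.map_comp_apply, hz, AlgPoints.map_apply, CartesianMonoidalCategory.lift_fst]
  have hzπ : AlgPoints.map (LinearSectionNet.proj (fiberι f t ≫ e) a) z =
      AlgPoints.map (familyPullback.snd (CartesianMonoidalCategory.lift (toX N e ≫ f) (proj N e)) (Λ ≫ (CartesianMonoidalCategory.lift (toSpecOver (dualProjectiveSpace N ℂ) ≫ t) (𝟙 (dualProjectiveSpace N ℂ))))) u := by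
    change AlgPoints.map (LinearSectionNet.emb (fiberι f t ≫ e) a ≫ snd _ _) z = _
    rw [AlgPoints.map_comp_apply, hz, AlgPoints.map_apply, CartesianMonoidalCategory.lift_snd]
  -- `ΘL z = u`
  have hembΘ : AlgPoints.map (emb N e) (AlgPoints.map Θ z) =
      CartesianMonoidalCategory.lift (AlgPoints.map (toX N e) (AlgPoints.map Θ z))
        (AlgPoints.map (proj N e) (AlgPoints.map Θ z)) := by
    conv_lhs => rw [eq_lift_map_fst_map_snd (AlgPoints.map (emb N e) _)]
    exact congrArg₂ _ (AlgPoints.map_comp_apply (emb N e) (fst _ _) _).symm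
      (AlgPoints.map_comp_apply (emb N e) (snd _ _) _).symm
  have h1 : AlgPoints.map (familyPullback.fst (CartesianMonoidalCategory.lift (toX N e ≫ f) (proj N e)) (Λ ≫ (CartesianMonoidalCategory.lift (toSpecOver (dualProjectiveSpace N ℂ) ≫ t) (𝟙 (dualProjectiveSpace N ℂ))))) (AlgPoints.map ΘL z) =
      AlgPoints.map (familyPullback.fst (CartesianMonoidalCategory.lift (toX N e ≫ f) (proj N e)) (Λ ≫ (CartesianMonoidalCategory.lift (toSpecOver (dualProjectiveSpace N ℂ) ≫ t) (𝟙 (dualProjectiveSpace N ℂ))))) u := by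
    rw [← AlgPoints.map_comp_apply, hΘL₁]
    apply AlgPoints.map_injective_of_mono (emb N e)
    rw [hembΘ, hemb, ← AlgPoints.map_comp_apply Θ (toX N e), hΘX, AlgPoints.map_comp_apply, hzσ, hx',
      ← AlgPoints.map_comp_apply Θ (proj N e), hΘP, AlgPoints.map_comp_apply, hzπ, hlam, hΛw, hproj]
  have h2 : AlgPoints.map (familyPullback.snd (CartesianMonoidalCategory.lift (toX N e ≫ f) (proj N e)) (Λ ≫ (CartesianMonoidalCategory.lift (toSpecOver (dualProjectiveSpace N ℂ) ≫ t) (𝟙 (dualProjectiveSpace N ℂ))))) (AlgPoints.map ΘL z) =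
      AlgPoints.map (familyPullback.snd (CartesianMonoidalCategory.lift (toX N e ≫ f) (proj N e)) (Λ ≫ (CartesianMonoidalCategory.lift (toSpecOver (dualProjectiveSpace N ℂ) ≫ t) (𝟙 (dualProjectiveSpace N ℂ))))) u := by
    rw [← AlgPoints.map_comp_apply, hΘL₂, hzπ]
  have hzu : AlgPoints.map ΘL z = u :=
    (familyPullback.isPullback (CartesianMonoidalCategory.lift (toX N e ≫ f) (proj N e)) (Λ ≫ (CartesianMonoidalCategory.lift (toSpecOver (dualProjectiveSpace N ℂ) ≫ t) (𝟙 (dualProjectiveSpace N ℂ))))).hom_ext h1 h2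
  exact ⟨z.pt, by rw [← AlgPoints.pt_map, hzu]⟩

/-- **The pencil of `X_t` as a surjective closed subscheme of the line `𝒴_L` of the family of
sections.** With `Θ : X̃_t ⟶ 𝒴` from `exists_pencilToSection` and `ℓ = Λ ≫ (H ↦ (t, H)) : ℙ¹ ⟶ S × (ℙᴺ)^*`,
the morphism `(Θ, π) : X̃_t ⟶ 𝒴_L := 𝒴 ×_{S × (ℙᴺ)^*} ℙ¹` is a closed immersion
(`isClosedImmersion_pencilToSectionLine`) which is surjective: its range is closed and contains every
closed point (`pt_mem_range_pencilToSectionLine`), hence everything (Jacobson).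
[cite: StacksProject, Tag 04XV] [cite: VoisinHodgeII2003, §2.1.1] -/
theorem exists_pencilToSectionLine [IsClosedImmersion (fiberι f t ≫ e).left] [IsAffine S.left]
    [LocallyOfFiniteType S.hom] (hf : IsSmoothProjectiveFamily f (n + 1))
    (hΛ : ∀ (w : Fin (1 + 1) → ℂ) (hw : w ≠ 0), ∃ hc : (fun i => w 1 * a 0 i - w 0 * a 1 i) ≠ 0,
      AlgPoints.map Λ (ProjectiveSpace.pointOfVec ℂ w hw) =
        ProjectiveSpace.pointOfVec ℂ (fun i => w 1 * a 0 i - w 0 * a 1 i) hc) :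
    ∃ ΘL : LinearSectionNet.total (fiberι f t ≫ e) a ⟶
        familyPullback (CartesianMonoidalCategory.lift (toX N e ≫ f) (proj N e))
          (Λ ≫ CartesianMonoidalCategory.lift (toSpecOver (dualProjectiveSpace N ℂ) ≫ t) (𝟙 (dualProjectiveSpace N ℂ))),
      ΘL ≫ familyPullback.snd _ _ = LinearSectionNet.proj (fiberι f t ≫ e) a ∧
      ΘL ≫ familyPullback.fst _ _ ≫ toX N e = LinearSectionNet.blowDown (fiberι f t ≫ e) a ≫ fiberι f t ∧
      IsClosedImmersion ΘL.left ∧ Surjective ΘL.left := by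
  have hXt : IsSmoothProjective (n + 1) (fiberOver f t) := hf.isSmoothProjective t
  haveI : IsSeparated S.hom := inferInstance
  haveI := isSeparated_total_hom f hf
  haveI := locallyOfFiniteType_total_hom f hf
  obtain ⟨Θ, hΘX, hΘP⟩ := exists_pencilToSection f e t a Λ hXt hΛ
  set ΘL := (familyPullback.isPullback (CartesianMonoidalCategory.lift (toX N e ≫ f) (proj N e))
    (Λ ≫ CartesianMonoidalCategory.lift (toSpecOver (dualProjectiveSpace N ℂ) ≫ t) (𝟙 (dualProjectiveSpace N ℂ)))).lift
    Θ (LinearSectionNet.proj (fiberι f t ≫ e) a) (pencilToSection_comm f e t a Λ hΘX hΘP) with hΘL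
  have hΘL₁ : ΘL ≫ familyPullback.fst _ _ = Θ := IsPullback.lift_fst _ _ _ _
  have hΘL₂ : ΘL ≫ familyPullback.snd _ _ = LinearSectionNet.proj (fiberι f t ≫ e) a := IsPullback.lift_snd _ _ _ _
  have hcl := isClosedImmersion_pencilToSectionLine f e t a Λ hf hΘX hΘL₁ hΘL₂
  refine ⟨ΘL, hΘL₂, by rw [← Category.assoc, hΘL₁, hΘX], hcl, ⟨?_⟩⟩
  -- surjective: the range is closed and contains every closed point
  haveI := hcl
  haveI := locallyOfFiniteType_section_hom e
  haveI : LocallyOfFiniteType (familyPullback (CartesianMonoidalCategory.lift (toX N e ≫ f) (proj N e))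
      (Λ ≫ CartesianMonoidalCategory.lift (toSpecOver (dualProjectiveSpace N ℂ) ≫ t) (𝟙 (dualProjectiveSpace N ℂ)))).hom := by
    rw [familyPullback_hom]
    haveI : LocallyOfFiniteType (Λ ≫ CartesianMonoidalCategory.lift (toSpecOver (dualProjectiveSpace N ℂ) ≫ t)
        (𝟙 (dualProjectiveSpace N ℂ))).left := by
      haveI : LocallyOfFiniteType (projectiveSpace 1 ℂ).hom := inferInstance
      have h : LocallyOfFiniteType ((Λ ≫ CartesianMonoidalCategory.lift (toSpecOver (dualProjectiveSpace N ℂ) ≫ t)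
          (𝟙 (dualProjectiveSpace N ℂ))).left ≫ (S ⊗ dualProjectiveSpace N ℂ).hom) := by
        rw [Over.w]; infer_instance
      exact locallyOfFiniteType_of_comp _ (S ⊗ dualProjectiveSpace N ℂ).hom
    have h1 := MorphismProperty.pullback_fst (P := @LocallyOfFiniteType)
      (CartesianMonoidalCategory.lift (toX N e ≫ f) (proj N e)).left
      (Λ ≫ CartesianMonoidalCategory.lift (toSpecOver (dualProjectiveSpace N ℂ) ≫ t) (𝟙 (dualProjectiveSpace N ℂ))).left
      inferInstance
    exact MorphismProperty.comp_mem @LocallyOfFiniteType _ _ h1 ‹LocallyOfFiniteType (universalHyperplaneSection N e).hom›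
  have hrange : Set.range ΘL.left.base = Set.univ := by
    refine eq_univ_of_closedPoints_subset (Y := familyPullback _ _) ΘL.left.isClosedEmbedding.isClosed_range
      fun y hy => ?_
    obtain ⟨u, rfl⟩ := EsnaultLevineViehweg.exists_algPoints_pt_eq (X := familyPullback _ _) (k := ℂ)
      (mem_closedPoints_iff.mp hy)
    exact pt_mem_range_pencilToSectionLine f e t a Λ hΛ hΘX hΘP hΘL₁ hΘL₂ u
  intro y
  have hy : y ∈ Set.range ΘL.left.base := hrange ▸ Set.mem_univ y
  exact hy

end PencilToSectionFamily

end Literature.AlgebraicGeometry.Motives.SectionFamily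

end
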